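import Literature.NumberTheory.EllipticCurves.IsogenyDescentWeilFunction
import HarnessLib

/-!
# Descent through an isogeny with rational cyclic kernel, II: the Kummer element `h(R)/h(Q₀)` of
# the cocycle `σ ↦ e(σR - R, T)` and the ratio `f(P)/f(P₀)` (Silverman, *AEC*, Exercise 10.1(c))

PROOF-ONLY file (theorems, no definition, no named fact), topic `NumberTheory/EllipticCurves`;
sequel of `IsogenyDescentWeilFunction`. Let `E/F` be an elliptic curve, `N` a prime invertible in
`F`, `T ∈ E(F̄)` a `Γ_F`-fixed point of order `N`, `f ∈ F̄(E)` with `div f = N(T) - N(O)` (a Kummer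
function `f_T`), and `h` a Weil function of `T` (`[N]^* f = c · hᴺ`). For a point `R ∈ E(F̄)` whose
multiple `P = N R` is `Γ_F`-fixed and `≠ O, T`, the `μ_N`-valued function
`χ_R(σ) = e(σR - R, T)` (the Weil pairing, tree `weilPairingFun`) is the cocycle of the
`φ̂`-Kummer map at `P` read through `E'[φ̂] ≅ μ_N` (Silverman X.4.9 / Exercise 10.1(c)). The tree's
`IsWeilFunction.smul_value` gives `σ(h(R)) = λ_σ · χ_R(σ) · h(R)` with an unknown scalar `λ_σ`
(`σ̃ h = λ_σ h`). This file removes `λ_σ` by a **base point**: for a `Γ_F`-FIXED `Q₀ ∈ E(F̄)` with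
`P₀ = N Q₀ ∉ {O, T}` one has `σ(h(Q₀)) = λ_σ h(Q₀)` (`e(O, T) = 1`), whence:

* `exists_kummerElement` — **`w = h(R)/h(Q₀)` satisfies `σ w = e(σR - R, T) · w` for all `σ` and
  `wᴺ · f(P₀) = f(P)`**: `w` is a Kummer element of the cocycle `χ_R`, with `N`-th power the RATIO
  `f(P)/f(P₀) ∈ F`.
* `value_smul_eq_of_fixed` — `f(P) ∈ F̄` is `Γ_F`-fixed when `f` is `Γ_F`-fixed (`σ̃ f = f`) and `P`
  is; `exists_algebraMap_eq_value`: then `f(P) = ι(a)` for some `a ∈ F` (Galois descent).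
* `exists_pow_mul_eq_of_weilPairing_eq` — **equal cocycles give ratios in `Fˣᴺ`**: if
  `e(σR₁ - R₁, T) = e(σR₂ - R₂, T)` for all `σ` then `f(N R₁) = uᴺ f(N R₂)`, `u ∈ F`
  (for `R₂ = R₁ + R'` with `R'` rational this is "`f(P + N R') ≡ f(P) mod Fˣᴺ`", i.e. the Kummer
  map `P ↦ f(P)` is constant on cosets of `N E(F)`; Silverman X.1.1(c) for the `φ̂`-descent).
* `exists_algebraMap_eq_prod_div` — the bookkeeping form used for INDEPENDENCE proofs: if `w₁, w₂, w₃`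
  are Kummer elements for `χ_{R₁}, χ_{R₂}, χ_{R₃}` and `χ_{R₁}^{a} χ_{R₂}^{b} χ_{R₃}^{c} = σζ/ζ`
  (a coboundary, `ζ ∈ F̄ˣ`), then `w₁^a w₂^b w₃^c / ζ` is `Γ_F`-fixed, hence its `N`-th power
  `(f(P₁)/f(P₀))^a (f(P₂)/f(P₀))^b (f(P₃)/f(P₀))^c · ζ^{-N}` lies in `F`... stated as: the product
  `w₁^a w₂^b w₃^c ζ⁻¹` equals `ι(u)` for some `u ∈ F`.

## References

* [SilvermanAEC2009] J. H. Silverman, *The Arithmetic of Elliptic Curves*, 2nd ed., III.§8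
  (Weil pairing via `g(X+S)/g(X)`), Thm. X.1.1(c) and its proof, Prop. X.4.9, Exercise 10.1(c).

## Design

Theorems only; conventions of `IsogenyDescentWeilFunction` (`F : Type u`, `N` prime with
`[Fact N.Prime] [NeZero (N : F)]`, values through `HasValueAt`, Galois action on `F̄` written
`galRingHom σ`).
-/

noncomputable section

open scoped Classical
open Polynomial

universe u

namespace WeierstrassCurve

open geomPoints Literature.NumberTheory.EllipticCurves.WeierstrassFunctionField
  Literature.NumberTheory.EllipticCurves

variable {F : Type u} [Field F] {W : WeierstrassCurve F} [W.IsElliptic]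
variable {N : ℕ} [Fact N.Prime] [NeZero (N : F)]

/-! ### Galois-fixed values -/

omit [W.IsElliptic] [Fact N.Prime] [NeZero (N : F)] in
/-- If `f` is `Γ_F`-fixed (`σ̃ f = f`) and `P ≠ O` is `Γ_F`-fixed, the value `f(P)` is
`Γ_F`-fixed: `σ(f(P)) = f(P)` (`σ̃ f` has value `σ(f(P))` at `σ P`, tree
`HasValueAt.galFunctionField`, and values are unique). [cite: SilvermanAEC2009, II.§2 (functions defined over K, Ex. 2.13)] -/
theorem value_smul_eq_of_fixed {f : W.geomFunctionField}
    (hffix : ∀ σ : Field.absoluteGaloisGroup F, W.galFunctionField σ f = f)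
    {P : W.geomPoints} (hP0 : P ≠ 0) (hPfix : ∀ σ : Field.absoluteGaloisGroup F, σ • P = P)
    {a : AlgebraicClosure F} (ha : W.HasValueAt f P a) (σ : Field.absoluteGaloisGroup F) :
    galRingHom σ a = a := by
  have h1 := ha.galFunctionField σ
  rw [hffix σ, hPfix σ] at h1
  exact h1.unique hP0 ha

omit [W.IsElliptic] [Fact N.Prime] [NeZero (N : F)] in
/-- **Galois descent for values**: under the hypotheses of `value_smul_eq_of_fixed`, `f(P) = ι(a)`
for some `a ∈ F` (`F` is perfect, being of characteristic prime to... — here: `F̄/F` Galois, Mathlib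
`InfiniteGalois.mem_range_algebraMap_iff_fixed`, requires `CharZero F`).
[cite: SilvermanAEC2009, II.§2 (Ex. 2.13)] -/
theorem exists_algebraMap_eq_value [CharZero F] {f : W.geomFunctionField}
    (hffix : ∀ σ : Field.absoluteGaloisGroup F, W.galFunctionField σ f = f)
    {P : W.geomPoints} (hP0 : P ≠ 0) (hPfix : ∀ σ : Field.absoluteGaloisGroup F, σ • P = P)
    {a : AlgebraicClosure F} (ha : W.HasValueAt f P a) :
    ∃ c : F, algebraMap F (AlgebraicClosure F) c = a :=
  (InfiniteGalois.mem_range_algebraMap_iff_fixed a).mpr fun σ ↦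
    value_smul_eq_of_fixed hffix hP0 hPfix ha σ

omit [W.IsElliptic] [Fact N.Prime] [NeZero (N : F)] in
/-- Galois descent in `F̄` (`CharZero F`), in the `galRingHom` spelling of the Weil-pairing files:
an element fixed by every `galRingHom σ` lies in `F`. [cite: SilvermanAEC2009, II.§2 (Ex. 2.13)] -/
theorem exists_algebraMap_of_forall_galRingHom [CharZero F] {x : AlgebraicClosure F}
    (hx : ∀ σ : Field.absoluteGaloisGroup F, galRingHom σ x = x) :
    ∃ c : F, algebraMap F (AlgebraicClosure F) c = x :=
  (InfiniteGalois.mem_range_algebraMap_iff_fixed x).mpr fun σ ↦ hx σ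

/-! ### The Kummer element of `χ_R(σ) = e(σR - R, T)` -/

section Kummer

variable {T : W.geomPoints} (hT : (N : ℤ) • T = 0) (hT0 : T ≠ 0)
  (hTfix : ∀ σ : Field.absoluteGaloisGroup F, σ • T = T)
  {f : W.geomFunctionField} (hf0 : f ≠ 0)
  (hford : ∀ Q : W.geomPoints, ord (W.baseChange (AlgebraicClosure F)).toAffine Q f =
    (N : ℤ) * ((if Q = T then 1 else 0) - (if Q = 0 then 1 else 0)))
include hT hT0 hTfix hf0 hford

omit hT0 in
/-- **The Kummer element of the cocycle `σ ↦ e(σR - R, T)`.** Let `R ∈ E(F̄)` with `P = N R`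
`Γ_F`-fixed and `≠ O, T`, and let `Q₀ ∈ E(F̄)` be `Γ_F`-FIXED with `P₀ = N Q₀ ≠ O, T`. If `f` has
values `a` at `P` and `a₀` at `P₀`, then there is `w ∈ F̄`, `w ≠ 0`, with
**`σ(w) = e(σR - R, T) · w`** for every `σ ∈ Γ_F` and **`wᴺ · a₀ = a`** (`w = h(R)/h(Q₀)` for a
Weil function `h` of `T`: `σ(h(R)) = λ_σ e(σR - R,T) h(R)`, `σ(h(Q₀)) = λ_σ h(Q₀)`, and
`h(R)ᴺ = f(P)/c`, `h(Q₀)ᴺ = f(P₀)/c`). [cite: SilvermanAEC2009, Exercise 10.1(c) with III.§8 and the proof of Thm. X.1.1(c)] -/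
theorem exists_kummerElement {R : W.geomPoints}
    (hR0 : (N : ℤ) • R ≠ 0) (hRT : (N : ℤ) • R ≠ T)
    (hRfix : ∀ σ : Field.absoluteGaloisGroup F, σ • ((N : ℤ) • R) = (N : ℤ) • R)
    {Q₀ : W.geomPoints} (hQ₀0 : (N : ℤ) • Q₀ ≠ 0) (hQ₀T : (N : ℤ) • Q₀ ≠ T)
    (hQ₀fix : ∀ σ : Field.absoluteGaloisGroup F, σ • Q₀ = Q₀)
    {a a₀ : AlgebraicClosure F} (ha : W.HasValueAt f ((N : ℤ) • R) a)
    (ha₀ : W.HasValueAt f ((N : ℤ) • Q₀) a₀) :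
    ∃ w : AlgebraicClosure F, w ≠ 0 ∧
      (∀ σ : Field.absoluteGaloisGroup F,
        galRingHom σ w = weilPairingFun (natCast_level_ne_zero F N) (σ • R - R) T * w) ∧
      w ^ N * a₀ = a := by
  have hNp : N.Prime := Fact.out
  set hNF := natCast_level_ne_zero F N
  have hNZ : (N : ℤ) ≠ 0 := by exact_mod_cast hNp.ne_zero
  have hNF' : ((N : ℤ) : F) ≠ 0 := by exact_mod_cast hNF
  -- the Weil function of `T` and `[N]^* f = c · h ^ N`
  set h := weilFn hNF hT with hh_def
  have hh : IsWeilFunction W N T h := isWeilFunction_weilFn hNF hT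
  have hh0 : h ≠ 0 := hh.1
  set Fz := (Isogeny.zsmul W (N : ℤ) hNZ).pullbackHom f with hFz
  have hFz0 : Fz ≠ 0 :=
    (map_ne_zero_iff _ (Isogeny.zsmul W (N : ℤ) hNZ).pullbackHom.injective).mpr hf0
  have hhN0 : h ^ N ≠ 0 := pow_ne_zero N hh0
  obtain ⟨c, hc0, hFc⟩ : ∃ c : AlgebraicClosure F, c ≠ 0 ∧
      Fz = algebraMap (AlgebraicClosure F) W.geomFunctionField c * h ^ N := by
    refine exists_eq_smul_of_ord_eq hhN0 hFz0 fun Q => ?_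
    obtain ⟨-, T', hT', hordh⟩ := hh
    rw [ord_pow _ hh0, hFz, ord_pullbackHom_zsmul hNZ hNF' Q f, hford, hordh]
    unfold torsionInd
    rw [smul_sub, hT', sub_eq_zero]
  -- values of `h` at `R` and `Q₀`
  have hvalF : ∀ {R : W.geomPoints} (_ : (N : ℤ) • R ≠ 0) (_ : (N : ℤ) • R ≠ T)
      {v : AlgebraicClosure F}, W.HasValueAt f ((N : ℤ) • R) v →
      ∃ w : AlgebraicClosure F, w ≠ 0 ∧ W.HasValueAt h R w ∧ v = c * w ^ N := by
    intro R hR hRT v hv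
    obtain ⟨w, hw0, hw⟩ := hh.exists_value hR hRT
    have hR0' : R ≠ 0 := by rintro rfl; exact hR (smul_zero _)
    have h1 : W.HasValueAt Fz R v := hasValueAt_pullbackHom_zsmul hNZ hR hv
    have h2 : W.HasValueAt Fz R (c * w ^ N) := by rw [hFc]; exact (hw.pow N).const_mul c
    exact ⟨w, hw0, hw, h1.unique hR0' h2⟩
  obtain ⟨w₁, hw₁0, hw₁, haw⟩ := hvalF hR0 hRT ha
  obtain ⟨w₀, hw₀0, hw₀, ha₀w⟩ := hvalF hQ₀0 hQ₀T ha₀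
  refine ⟨w₁ / w₀, div_ne_zero hw₁0 hw₀0, fun σ => ?_, ?_⟩
  · -- Galois: `σ w₁ = λ e(σR - R, T) w₁`, `σ w₀ = λ w₀`
    obtain ⟨lam, hlam0, hlam⟩ := hh.exists_galFunctionField_eq σ (hTfix σ)
    have hσR : (N : ℤ) • (σ • R - R) = 0 := by rw [smul_sub, smul_comm, hRfix σ, sub_self]
    have hσQ₀ : (N : ℤ) • (σ • Q₀ - Q₀) = 0 := by rw [hQ₀fix σ, sub_self, smul_zero]
    have e1 := hh.smul_value hNF hT σ (hTfix σ) hlam hR0 hRT hσR hw₁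
    have e0 := hh.smul_value hNF hT σ (hTfix σ) hlam hQ₀0 hQ₀T hσQ₀ hw₀
    rw [hQ₀fix σ, sub_self, weilPairingFun_zero_left hNF hT, mul_one] at e0
    rw [map_div₀, e1, e0]
    field_simp
  · -- `(w₁/w₀)^N a₀ = c w₁^N = a`
    rw [haw, ha₀w, div_pow]
    field_simp

omit hT0 in
/-- **Equal cocycles give ratios in `Fˣᴺ`** (constancy of `P ↦ f(P) mod Fˣᴺ` on cosets of
`φ̂(E'(F))`, Silverman X.1.1(c) / Exercise 10.1(c)): for `R₁, R₂` with `N R_i` `Γ_F`-fixed and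
`≠ O, T`, if `e(σR₁ - R₁, T) = e(σR₂ - R₂, T)` for all `σ`, then `f(N R₁) = uᴺ · f(N R₂)` for some
`u ∈ F` (`CharZero F` for Galois descent). [cite: SilvermanAEC2009, Thm. X.1.1(c) (proof) and Exercise 10.1(c)] -/
theorem exists_pow_mul_eq_of_weilPairing_eq [CharZero F] {R₁ R₂ : W.geomPoints}
    (hR₁0 : (N : ℤ) • R₁ ≠ 0) (hR₁T : (N : ℤ) • R₁ ≠ T)
    (hR₁fix : ∀ σ : Field.absoluteGaloisGroup F, σ • ((N : ℤ) • R₁) = (N : ℤ) • R₁)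
    (hR₂0 : (N : ℤ) • R₂ ≠ 0) (hR₂T : (N : ℤ) • R₂ ≠ T)
    (hR₂fix : ∀ σ : Field.absoluteGaloisGroup F, σ • ((N : ℤ) • R₂) = (N : ℤ) • R₂)
    {Q₀ : W.geomPoints} (hQ₀0 : (N : ℤ) • Q₀ ≠ 0) (hQ₀T : (N : ℤ) • Q₀ ≠ T)
    (hQ₀fix : ∀ σ : Field.absoluteGaloisGroup F, σ • Q₀ = Q₀)
    (hpair : ∀ σ : Field.absoluteGaloisGroup F,
      weilPairingFun (natCast_level_ne_zero F N) (σ • R₁ - R₁) T =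
        weilPairingFun (natCast_level_ne_zero F N) (σ • R₂ - R₂) T)
    {a₁ a₂ a₀ : AlgebraicClosure F} (ha₁ : W.HasValueAt f ((N : ℤ) • R₁) a₁)
    (ha₂ : W.HasValueAt f ((N : ℤ) • R₂) a₂) (ha₀ : W.HasValueAt f ((N : ℤ) • Q₀) a₀) :
    ∃ u : F, u ≠ 0 ∧ a₁ = algebraMap F (AlgebraicClosure F) u ^ N * a₂ := by
  obtain ⟨w₁, hw₁0, hσ₁, hw₁⟩ := exists_kummerElement hT hTfix hf0 hford hR₁0 hR₁T hR₁fix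
    hQ₀0 hQ₀T hQ₀fix ha₁ ha₀
  obtain ⟨w₂, hw₂0, hσ₂, hw₂⟩ := exists_kummerElement hT hTfix hf0 hford hR₂0 hR₂T hR₂fix
    hQ₀0 hQ₀T hQ₀fix ha₂ ha₀
  -- `w₁ / w₂` is `Γ_F`-fixed
  have hfix : ∀ σ : Field.absoluteGaloisGroup F, galRingHom σ (w₁ / w₂) = w₁ / w₂ := fun σ ↦ by
    rw [map_div₀, hσ₁ σ, hσ₂ σ, hpair σ]
    have hσR₂ : (N : ℤ) • (σ • R₂ - R₂) = 0 := by rw [smul_sub, smul_comm, hR₂fix σ, sub_self]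
    have he0 : weilPairingFun (natCast_level_ne_zero F N) (σ • R₂ - R₂) T ≠ 0 := by
      intro h0
      have h1 := weilPairingFun_pow (natCast_level_ne_zero F N) hσR₂ hT
      rw [h0, zero_pow (Fact.out : N.Prime).ne_zero] at h1
      exact zero_ne_one h1
    field_simp
  obtain ⟨u, hu⟩ := exists_algebraMap_of_forall_galRingHom hfix
  have ha₀0 : a₀ ≠ 0 := by
    intro h0
    rw [h0, mul_zero] at hw₁
    -- then `a₁ = 0`; but `w₁^N a₀ = a₁` and also ... use `hw₂` similarly: both zero is allowed?
    -- `a₁ = 0` contradicts nothing directly; instead derive from `f` having no zero at `N R₁`: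
    exact absurd hw₁.symm (by
      intro h1
      have hR0' : (N : ℤ) • R₁ ≠ 0 := hR₁0
      obtain ⟨v, hv0, hv⟩ := exists_hasValueAt_ne_zero_of_ord_eq_zero hf0 hR0' (by
        rw [hford, if_neg hR₁T, if_neg hR₁0, sub_zero, mul_zero])
      exact hv0 ((hv.unique hR0' ha₁).trans h1))
  refine ⟨u, ?_, ?_⟩
  · intro hu0
    rw [hu0, map_zero] at hu
    exact div_ne_zero hw₁0 hw₂0 hu.symm
  · have e1 : w₁ = algebraMap F (AlgebraicClosure F) u * w₂ := by
      rw [hu, div_mul_cancel₀ _ hw₂0]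
    have : w₁ ^ N * a₀ = algebraMap F (AlgebraicClosure F) u ^ N * (w₂ ^ N * a₀) := by
      rw [e1, mul_pow, mul_assoc]
    rw [hw₁, hw₂] at this
    exact this

omit [W.IsElliptic] [Fact N.Prime] [NeZero (N : F)] hT hT0 hTfix hf0 hford in
/-- **Fixed combinations** (the bookkeeping of independence proofs): let `w₁, w₂, w₃ ∈ F̄ˣ` satisfy
`σ w_i = χ_i(σ) w_i` and let `ζ ∈ F̄ˣ` with `χ₁(σ)^a χ₂(σ)^b χ₃(σ)^c · ζ = σ ζ` for all `σ` (the
product cocycle is the coboundary of `ζ`); then `w₁^a w₂^b w₃^c / ζ` is `Γ_F`-fixed, so equals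
`ι(u)`, `u ∈ F` (`CharZero F`). Purely multiplicative Galois algebra.
[cite: SilvermanAEC2009, Thm. X.1.1(c) (proof)] -/
theorem exists_algebraMap_eq_prod_div [CharZero F] {w₁ w₂ w₃ ζ : AlgebraicClosure F}
    {χ₁ χ₂ χ₃ : Field.absoluteGaloisGroup F → AlgebraicClosure F}
    (h₁ : ∀ σ, galRingHom σ w₁ = χ₁ σ * w₁) (h₂ : ∀ σ, galRingHom σ w₂ = χ₂ σ * w₂)
    (h₃ : ∀ σ, galRingHom σ w₃ = χ₃ σ * w₃) (hζ0 : ζ ≠ 0) (a b c : ℕ)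
    (hcob : ∀ σ, χ₁ σ ^ a * χ₂ σ ^ b * χ₃ σ ^ c * ζ = galRingHom σ ζ) :
    ∃ u : F, algebraMap F (AlgebraicClosure F) u = w₁ ^ a * w₂ ^ b * w₃ ^ c / ζ := by
  refine exists_algebraMap_of_forall_galRingHom fun σ ↦ ?_
  rw [map_div₀, map_mul, map_mul, map_pow, map_pow, map_pow, h₁, h₂, h₃, ← hcob σ]
  have hσζ0 : χ₁ σ ^ a * χ₂ σ ^ b * χ₃ σ ^ c * ζ ≠ 0 := by
    rw [hcob σ]; exact (map_ne_zero_iff _ (galRingHom σ).injective).mpr hζ0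
  have hprod0 : χ₁ σ ^ a * χ₂ σ ^ b * χ₃ σ ^ c ≠ 0 := left_ne_zero_of_mul hσζ0
  rw [mul_pow, mul_pow, mul_pow, div_eq_div_iff hσζ0 hζ0]
  ring

end Kummer

end WeierstrassCurve

end
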